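import Summits.QuantumFields.YangMills.Theorems.CheckerboardTrialityCellCoordPermKit
import Summits.QuantumFields.YangMills.Theorems.BalabanLadderROTDefs
import Summits.QuantumFields.YangMills.Theorems.LangevinControlUVOSLegsFromFemtoAndGapStubHypercubicSignedPerm
import HarnessLib

/-!
# Route `CheckerboardTriality`, crux `TrialityOnCheckerboardCells` (stmt-QuantumFields-22666), line «coset» —
# ★ the permutation half of `stub_cellHyperoctahedral`, UNCONDITIONALLY

Helper file (`--supports stmt-QuantumFields-22666 --as helper`; free-hands width seat `ym-line-sfw-p2-w4` g14; part (B) of the split with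
`ym-line-fcl-p3` g13's ✓p653748 = part (A)).  Definition-free, 0 sorry, standard axioms.  No item is closed; no summit, no crux and no
mass gap is proved by this file (R2d is a RECORD rung).

On the kit `Theorems/CheckerboardTrialityCellCoordPermKit.lean` (coordinate permutations act on every period cell; the cell
distributions of `P_π·F` and `F` agree for all large `k` along any scheme): the checkerboard period lattices `(2L_k+1)·D₄` are stable under
every coordinate permutation (`sitePerm_mem_of_checkerboard`), a linear isometry acting on `ℤ⁴` as `z ↦ z ∘ π⁻¹` is `P_π`
(`eq_coordPerm_of_apply_siteToE`), whence ★ `stub_cellHyperoctahedral_coordPerm`: the registered stub's signature with «`R(ℤ⁴) ⊆ ℤ⁴`»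
replaced by «`R` acts on `ℤ⁴` as a coordinate permutation» (24 of the 384 elements of `W(B₄)`) — the cell rotation defect is eventually
IDENTICALLY `0`, with no use of `MomentBounds6`, of UV compactness, of King's radius or of the cover transfer.  For the other 360 signed
permutations the defect is an `O(a_k)` shift defect of the corner-based composite and is `o(1)` only modulo `CheckerboardCoverTransfer`
(part (A), `CheckerboardTrialityCellHyperoctahedral.cellHyperoctahedral_of_coverTransfer`).

References: C. King, CMP 103 (1986) §2; J. H. Conway, N. J. A. Sloane, SPLAG (1999) Ch. 4 §7.1.
-/

set_option autoImplicit false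

noncomputable section

open scoped SchwartzMap BigOperators
open MeasureTheory Filter Topology
open Literature.MathematicalPhysics.QuantumFieldTheory Literature.MathematicalPhysics.QuantumLattice
open Literature.MathematicalPhysics.AQFT
open Literature.Probability.LatticeModels (Site box)
open Summit.QuantumFields.YangMills.Cruxes.OSLegsFromFemtoAndGap.DlrCollarTransfer (MomentBounds6)
open Summit.QuantumFields.YangMills.Cruxes.OSLegsAtWeakCouplingC.Y2Bridge (King.KingClass)
open Summit.QuantumFields.YangMills.Theorems.OSLegsFromFemtoAndGap (coordPerm coordPerm_single linearIsometryEquiv_eq_of_single)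
open Summit.QuantumFields.YangMills.Theorems.ROT (IsLegScheme PeriodCell)
open Summit.QuantumFields.YangMills.Theorems.NPointIsotropy.Negative (E4)

namespace Summit.QuantumFields.YangMills.Theorems.CheckerboardTrialityCellCoordPerm

/-! ## §7 ★ The permutation half of the registered stub, unconditionally -/

/-- The checkerboard period lattices `M·D₄` are stable under every coordinate permutation (the coordinate sum is permutation
invariant). [cite: ConwaySloane1999, Ch. 4 §7.1] -/
theorem sitePerm_mem_of_checkerboard (τ : Equiv.Perm (Fin 4)) (M : ℤ) {C : PeriodCell 4}
    (hC : (C.P : Set (Fin 4 → ℤ)) = {z | ∃ w : Fin 4 → ℤ, Even (∑ i, w i) ∧ z = M • w}) (p : Site 4) (hp : p ∈ C.P) :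
    sitePerm τ p ∈ C.P := by
  have hp' : p ∈ (C.P : Set (Fin 4 → ℤ)) := hp
  rw [hC] at hp'
  obtain ⟨w, hw, rfl⟩ := hp'
  have h : sitePerm τ (M • w) ∈ (C.P : Set (Fin 4 → ℤ)) := by
    rw [hC]
    refine ⟨sitePerm τ w, ?_, rfl⟩
    simp only [Literature.MathematicalPhysics.QuantumLattice.sitePerm_apply]
    rwa [Equiv.sum_comp τ.symm w]
  exact h

/-- The lattice point `eᵢ ∈ ℤ⁴` embeds to the basis vector `eᵢ ∈ ℝ⁴` (copy of `CheckerboardTrialityCellHyperoctahedral.siteToE_single`,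
kept local to stay out of the route cone). [folklore] -/
private theorem siteToE_single' (i : Fin 4) :
    siteToE (Pi.single i (1 : ℤ) : Fin 4 → ℤ) = (EuclideanSpace.single i (1 : ℝ) : E4) := by
  ext j
  by_cases h : j = i <;> simp [siteToE_apply, h]

/-- A linear isometry of `ℝ⁴` acting on the lattice points as the coordinate permutation `z ↦ z ∘ π⁻¹` IS `P_π`. [folklore] -/
theorem eq_coordPerm_of_apply_siteToE (R : E4 ≃ₗᵢ[ℝ] E4) (π : Equiv.Perm (Fin 4))
    (hR : ∀ z : Fin 4 → ℤ, R (siteToE z) = siteToE (fun i => z (π.symm i))) : R = coordPerm π := by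
  refine linearIsometryEquiv_eq_of_single fun i => ?_
  have h1 : R (EuclideanSpace.single i 1) = siteToE (fun j => (Pi.single i (1 : ℤ) : Fin 4 → ℤ) (π.symm j)) := by
    rw [← hR (Pi.single i 1), siteToE_single']
  have h2 : (fun j => (Pi.single i (1 : ℤ) : Fin 4 → ℤ) (π.symm j)) = Pi.single (π i) 1 := Literature.MathematicalPhysics.QuantumLattice.sitePerm_single π i 1
  rw [h1, h2, siteToE_single', coordPerm_single]

/-- ★ **The permutation half of `stub_cellHyperoctahedral`, UNCONDITIONALLY** — the registered stub's signature with the hypothesis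
«`R(ℤ⁴) ⊆ ℤ⁴`» replaced by «`R` acts on `ℤ⁴` as a coordinate permutation» (the subgroup `S₄` of `W(B₄)`): the cell rotation defect is
eventually IDENTICALLY zero along the scheme, hence tends to `0` — exact symmetry of the checkerboard cells, their Wilson weights and
Haar measures, and of the corner-based composite under PERMUTATIONS; `MomentBounds6`, the leg-scheme ranges and King's radius are
not used. [cite: King1986, §2] [cite: ConwaySloane1999, Ch. 4 §7.1] -/
theorem stub_cellHyperoctahedral_coordPerm :
  open Literature.MathematicalPhysics.QuantumFieldTheory Literature.MathematicalPhysics.QuantumLattice Literature.MathematicalPhysics.AQFT Literature.Probability.LatticeModels Summit.QuantumFields.YangMills.Cruxes.OSLegsFromFemtoAndGap.DlrCollarTransfer Summit.QuantumFields.YangMills.Cruxes.OSLegsAtWeakCouplingC.Sketch Summit.QuantumFields.YangMills.Cruxes.OSLegsAtWeakCouplingC.Y2Bridge Summit.QuantumFields.YangMills.Theorems.ROT in ∀ (G : Type) [Group G] [TopologicalSpace G] [IsTopologicalGroup G] [CompactSpace G], IsCompactSimpleLieGroup G → letI : MeasurableSpace G := borel G; haveI : BorelSpace G := ⟨rfl⟩;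 ∀ (r : LatticeRep G) (a : ℝ → ℝ), (∀ β, 0 < a β) → Tendsto a atTop (nhds 0) → MomentBounds6 G r a → ∀ sch : SpeciesScheme (YMSpecies G), IsLegScheme a sch → ∀ C : ℕ → PeriodCell 4, (∀ k, ((C k).P : Set (Fin 4 → ℤ)) = {z | ∃ w : Fin 4 → ℤ, Even (∑ i, w i) ∧ z = ((2 * sch.L k + 1 : ℕ) : ℤ) • w} ∧ box 4 (sch.L k) ⊆ (C k).reps) → ∀ r₀ : ℝ, ∀ (n : ℕ), 2 ≤ n → ∀ F ∈ King.KingClass n r₀, ∀ R : EuclideanSpace ℝ (Fin 4) ≃ₗᵢ[ℝ] EuclideanSpace ℝ (Fin 4), (∃ π : Equiv.Perm (Fin 4), ∀ z : Fin 4 → ℤ, R (siteToE z) = siteToE (fun i => z (π.symm i))) → Tendsto (fun k => (C k).dist r.ρ (sch.β k) (fun z => (sch.a k) • siteToE z) r.curvature.F ((C k).mean r.ρ (sch.β k) r.curvature.F) n (linActMulti R F) - (C k).dist r.ρ (sch.β k) (fun z => (sch.a k) • siteToE z) r.curvature.F ((C k).mean r.ρ (sch.β k) r.curvature.F) n F)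 atTop (nhds 0) := by
  intro G _ _ _ _ _hG
  letI : MeasurableSpace G := borel G
  haveI : BorelSpace G := ⟨rfl⟩
  intro r a _ha _ha0 _hMB sch _hsch C hC r₀ n _hn F hF R hR
  obtain ⟨π, hπR⟩ := hR
  obtain ⟨-, hFc, -, -⟩ := hF
  rw [eq_coordPerm_of_apply_siteToE R π hπR]
  have hev := cellDist_linActMulti_coordPerm_eventuallyEq r.ρ r.continuous π sch sch.β
    (fun k => (C k).mean r.ρ (sch.β k) r.curvature.F) C (fun k => (hC k).2)
    (fun k p hp => sitePerm_mem_of_checkerboard π _ (hC k).1 p hp)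
    (fun k p hp => sitePerm_mem_of_checkerboard π.symm _ (hC k).1 p hp)
    r.curvature.F (curvature_relabelConfig_edgePerm r π) F hFc
  refine tendsto_const_nhds.congr' (hev.mono fun k hk => ?_)
  simp only [hk, sub_self]

end Summit.QuantumFields.YangMills.Theorems.CheckerboardTrialityCellCoordPerm

end
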